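import Mathlib
import HarnessLib
import Summits.AnomalousDissipation.AnomalousDissipation.Theses.PointSink
import Literature.Analysis.FluidPDE.SteadyStrainedNS
import Summits.AnomalousDissipation.AnomalousDissipation.Theorems.PointSinkConeDesingularisationStubOrient
import Summits.AnomalousDissipation.AnomalousDissipation.Theorems.PointSinkConeDesingularisationStubFarFieldNontrivial
import Summits.AnomalousDissipation.AnomalousDissipation.Theorems.PointSinkConeDesingularisationStubEnvelopeOfFarField
import Summits.AnomalousDissipation.AnomalousDissipation.Theorems.PointSinkConeDesingularisationStubDissipationPosOfFarField
import Summits.AnomalousDissipation.AnomalousDissipation.Theorems.PointSinkConeDesingularisationStubDssFluxRigidity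
import Summits.AnomalousDissipation.AnomalousDissipation.Theorems.PointSinkConeDesingularisationStubC1ConeFluxless
import Literature.Analysis.FluidPDE.SteadyNSLiouville
import Literature.Analysis.FluidPDE.SteadyNSLiouvilleL3AnnulusProofs
import Literature.Analysis.FluidPDE.SteadyLiouvilleNineHalvesProofs
import Summits.AnomalousDissipation.AnomalousDissipation.Theorems.PointSinkSolitonTransplantStubTestedRescaledNS
import Summits.AnomalousDissipation.AnomalousDissipation.Theorems.PointSinkSolitonTransplantStubShellDefectScaling
import Summits.AnomalousDissipation.AnomalousDissipation.Theorems.PointSinkSolitonTransplantStubLocalL2Convergence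
import Summits.AnomalousDissipation.AnomalousDissipation.Theorems.PointSinkSolitonTransplantStubFarFieldWeakEuler
-- (the landed `Theorems/PointSinkConeDesingularisationNodeClass.lean`, p167658, packages the two node-class facts below;
--  this workfile proves them from the same ingredients so that it elaborates before that module is built on the farm)

/-!
# Line `Sketch` — crux `PointSink.ConeDesingularisation` (stmt-AnomalousDissipation-19034), skeleton v6

Lead skeleton (v1–v4: prover-line-stmt-AnomalousDissipation-19034-0; v5: continuation lead
prover-line-stmt-AnomalousDissipation-19034-c1-0, 2026-08-17, cycle 2; v6 = v5 + the landed node-class tools p167658).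

v5 — WHAT CHANGED. The rank-2 sibling crux `PointFluxCone` (stmt-AnomalousDissipation-19033) is PROVED
(`Summit.AnomalousDissipation.AnomalousDissipation.Theorems.PointFluxCone_of`, closed 2026-08-17T14:16Z: a
dilation-periodised Choffrut–Székelyhidi wild box, fluxless across spheres by its own account). Since the
crux is literally `PointFluxCone → CascadeSoliton` with the far field RE-QUANTIFIED in the conclusion, the
crux is now unconditionally equivalent to the support node `CascadeSoliton` (stmt-AnomalousDissipation-19036)
— `coneDesingularisation_iff_cascadeSoliton`, proposed p167258 under `Theorems/ConeDesingularisation/Negative/`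
together with the negative lemma `SteadyDSolutionLiouvilleProblem → wang2025_rem21_DSolution_tendsto_const →
¬ ConeDesingularisation` (kill criterion (k2) with its cone conjunct discharged). Accordingly the v4 stub
`stub_core` (far field PINNED to the given inward cone — strictly stronger than the composition needs, and
mechanism-less for the fluxless cone actually delivered) is RESHAPED to the minimal stub
`stub_cascadeSolitonCore`: the node `CascadeSoliton` minus the two clauses cycle 1 proved redundant (the
`R^{5/3}` envelope, stub 4; positivity of the dissipation, stub 5). `ConeDesingularisation_of` discards the
hypothesis and runs the cycle-1 transfer. Stubs 1–2 (orientation, non-triviality of a flux cone) stay as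
landed lemmas about the hypothesis class but are no longer links of the chain. The open mathematics is
unchanged and now isolated verbatim: a smooth steady unforced NS₁ solution on `ℝ³` with finite Dirichlet
integral, shell-`L²`-asymptotic to a non-trivial (−2/3)-DSS field = a counterexample to Galdi's Liouville
problem in the critical `L²`-mass class (open; consensus expects Liouville).

THE CRUX. `ConeDesingularisation ≡ (PointFluxCone → CascadeSoliton)` (refuter, `Iff.rfl`): a
(−2/3)-discretely-self-similar weak Euler cone on `ℝ³ ∖ {0}` with non-zero radial energy-flux log-mean
desingularises to a smooth steady unforced unit-viscosity Navier–Stokes solution `(Q, P)` on `ℝ³` with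
the L²-mass envelope `∫_{B_R}|Q|² ≤ C R^{5/3}`, finite non-zero dissipation and a non-trivial DSS far
field in shell-`L²`.

THE LINE (`Sketch`, ideator k2: cards `abc-window-selection` + `bernoulli-driven-blowdown`). The line's
`Sketch.lean` is a Prop-sketch (first lemmas `DSSFluxRigidity`, `HolderHalfFluxRigidity`,
`BernoulliBallEnergyBound`, `BlowDownCovariance`, …), not a stub skeleton; this file is the card's
TRANSFER paragraph made formal — "C⁺ (a soliton CORE shell-asymptotic to the given, inward-oriented cone)
⟹ CascadeSoliton ⟹ C" — with every clause of the conclusion that is REDUNDANT given the far-field clause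
discharged by a provable stub, so that the single stub carrying new mathematics (v1–v4 `stub_core`, v5
`stub_cascadeSolitonCore`; the lead's)
is the crux in its sharpest form: an entire smooth steady NS₁ solution with finite Dirichlet integral,
shell-`L²`-asymptotic (rate `o(λ^{5k/3})`) to the flux cone. Orientation is fixed first (`stub_orient`,
`V ↦ −V` flips the flux sign and preserves every other clause: the soliton's far field must carry energy
INWARD, `∫|∇Q|² = −lim ∮ (P + ½|Q|²) Q·n`). Then, for ANY continuous `Q` shell-asymptotic to a DSS `V`:
the envelope is automatic (`stub_envelopeOfFarField`: `∫_{shell k}|V|² = λ^{5k/3} ∫_{shell 0}|V|²` by the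
DSS change of variables, geometric sum); `0 < ∫|∇Q|²` is automatic once the far field is non-trivial
(`stub_dissipationPosOfFarField`: `∫|∇Q|² = 0 ⇒ Q ≡ a`; `a = 0` leaves the constant shell error
`∫_{shell 0}|V|² > 0`, `a ≠ 0` makes it grow like `λ^{4k/3}`); and non-triviality of the cone on the
fundamental shell follows from the non-zero flux (`stub_farFieldNontrivial`: `V = 0` a.e. on the shell would
make the flux density vanish a.e.). Steady smooth `⇒` time-constant classical is the tree's
`isSteadyClassicalNS_iff_const`.

Registered stubs (def-free signatures; `theorem stub_<name> : … := by sorry`; the composition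
`ConeDesingularisation_of` concludes the route decl BY NAME with sorries only inside `stub_*`):
* `stub_orient` (S; LANDED p158443) — `PointFluxCone` with the flux log-mean `< 0` (replace `V` by `−V` if
  needed: the weak Euler pairing is quadratic in `V`, the divergence pairing and the DSS law are linear,
  the flux density is odd).
* `stub_farFieldNontrivial` (S; LANDED p158441) — non-zero flux log-mean `⇒ 0 < ∫_{1<|x|<λ} |V|²`.
* `stub_cascadeSolitonCore` (XL / open-problem class; HARDEST; the lead's; v5 reshape of v4's `stub_core`,
  whose far field was pinned to the given cone) — a smooth steady unforced NS₁ solution with `∫|∇Q|² < ∞`,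
  shell-`L²`-asymptotic to SOME non-trivial (−2/3)-DSS field `V`: the Liouville-violating object (Galdi's
  Liouville problem in the critical L²-mass class) = `CascadeSoliton` minus its redundant clauses.
* `stub_envelopeOfFarField` (M; LANDED p158932) — shell asymptotics to a DSS `V` `⇒` the `R^{5/3}` envelope.
* `stub_dissipationPosOfFarField` (M; LANDED p159054) — shell asymptotics to a NON-TRIVIAL DSS `V` and
  `∫|∇Q|² < ∞` `⇒ 0 < ∫|∇Q|²`.

Registered TOOLS stubs (landed `--supports`, not links of the chain; the line's bookkeeping around
the core stub, i.e. the card's first lemmas `BlowDownCovariance` / `BernoulliBallDissipationIdentity` in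
whole-space form):
* `stub_blowdownCovariance` (M; LANDED p161105) — exact NS covariance: `u_k(y) = λ^{2k/3} Q(λ^k y)`,
  `p_k(y) = λ^{4k/3} Pr(λ^k y)` solve the UNFORCED steady system at viscosity `ν_k = λ^{-k/3}`; the normalised
  shell-`k` error of `Q` against a DSS `V` equals the shell-`0` error of `u_k`; `ν_k ∫_{B_1}|∇u_k|² =
  ∫_{B_{λ^k}}|∇Q|²`. So the core stub ⟺ a steady vanishing-viscosity family of blow-downs of ONE entire
  solution converging to the cone in `L²` of the fundamental shell with `ν`-independent dissipation.
* `stub_solitonEnergyFlux` (M; LANDED p161070) — soliton ENERGY–FLUX IDENTITY: for a steady unforced NS₁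
  solution with finite Dirichlet integral `D` and the `R^{5/3}` envelope, and every `φ ∈ C²_c`,
  `∫ (Dφ_k·Q)(½|Q|² + Pr) → φ(0)·D` along `φ_k = φ((λ^k)⁻¹·)`: the dissipation is the limit of the tested
  INWARD energy flux through DSS-receding shells (whence the orientation of stub 1; and, for far fields
  attained in `L³ × L^{3/2}` on shells, `D·log λ = −`(flux log-mean of the cone)).
* `stub_radialFluxShellInvariance` (M; LANDED p162541) — D1 part 1: for `W ∈ L¹_loc(ℝ³∖0)` weakly
  divergence-free off the origin, `∫_{a<|x|<b} ⟨W,x⟩/|x|²` depends only on `b/a` (dilation-difference radial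
  test functions `Ξ(|x|²)`, plateau limits; no polar coordinates).
* `stub_dssFluxRigidity` (M; LANDED p163455) — D1 = the line's FIRST LEMMA `DSSFluxRigidity`: a DSS weak cone
  whose head `H = ½|V|² + P` is RENORMALISED (`div(β(H)V) = 0` weakly off `0` for all `C¹` bounded-slope `β`,
  `β(0) = 0`) has ZERO flux log-mean (truncated fluxes are shell-invariant, hence `I(b) = I(bλ^{4/3})`, and tend
  to `0` / to the flux as `b → 0` / `b → ∞`). Contrapositive (`pointFluxCone_head_not_renormalised` below): the
  cone of the hypothesis has a NON-renormalised head — the class information the card's selection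
  mechanism consumes; and the k1 branch made precise (`not_pointFluxCone_of_weakConeRenormalisation`).
* `stub_c1ConeFluxless` (M; LANDED p164296) — Shvydkoy 2018 Lemma 6.1 in DSS generality: a cone `C¹` off the
  origin solving steady Euler classically there is renormalised (chain rule + Bernoulli `V·∇H = 0`), hence
  fluxless: `PointFluxCone` has no `C¹` witness (`pointFluxCone_no_C1_witness` below).
* `stub_coneDesingularisationNodeClassTools` (M; LANDED p167658, lead c1) — NECESSARY CONDITIONS ON THE NODE:
  (i) the shell-`L²` far field `V` of ANY entire smooth steady NS₁ solution is a very weak steady Euler field,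
  weakly divergence-free, off the origin (blow-down `Q_k = (λ^k)^{2/3}Q(λ^k·)`, viscosity `(λ^k)^{-1/3} → 0`,
  `L²`-convergence on every annulus; composes the four landed stubs of crux 19035); (ii) Seregin–Wang `L³`
  floor (tree `sereginWang_liouville_L3_annulus_holds`): a universal `δ > 0` with
  `δ·∫|∇Q|² < (liminf_R R^{-1/3}‖Q‖_{L³(R/2≤|x|<R)})³` — the far field charges every large dyadic annulus in
  `L³` at the critical rate, by the dissipation (`node_farField_isEulerCone`, `node_annular_L3_floor` below).

Disproof.lean for this crux (cdisprove cycle 1, tree `Cruxes/ConeDesingularisation/Disproof.lean` @14:16Z; certified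
copies under `Theorems/ConeDesingularisation/Negative/{FarFieldMass,LiouvilleReduction,SketchStubs,LpEscape}.lean`):
used here — `crux_iff`/`not_crux_iff` (shape), `not_cascadeSoliton_of_liouville` (composed with `PointFluxCone_of` in
p167258), `shell_mass_floor` / `not_memLp_of_shell_mass_floor` (why no printed Liouville criterion bites the stub).
-/

noncomputable section

-- `Summit.<Summit>.<Problem>`: single-conjunct summit, the duplicate namespace is mandated (CONVENTIONS §2).
set_option linter.dupNamespace false

namespace Summit.AnomalousDissipation.AnomalousDissipation.Cruxes.ConeDesingularisation.Sketch

open MeasureTheory Filter Topology Set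
open Literature.Analysis.FunctionSpaces Literature.Analysis.FluidPDE

/-- Velocity values / points of `ℝ³`. -/
local notation "E³" => EuclideanSpace ℝ (Fin 3)

/-! ## Registered stubs -/

/-- **Stub 1 — `stub_orient` (S; provable now).** A point-flux cone may be taken with NEGATIVE
(inward) radial energy-flux log-mean: if the given cone has positive log-mean, replace `V` by `−V`
(and keep `P`): measurability, the DSS laws, local integrability, the weak Euler identity (quadratic in
`V`), the weak divergence identity (linear) and the integrability of the flux density are preserved, and
the flux density `(½|V|² + P)(V·x)/|x|²` changes sign. -/
theorem stub_orient :
    Summit.AnomalousDissipation.AnomalousDissipation.Theses.PointSink.PointFluxCone →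
    ∃ (lam : ℝ) (V : E³ → E³) (P : E³ → ℝ), 1 < lam ∧ AEStronglyMeasurable V volume ∧
      (∀ x : E³, x ≠ 0 → V (lam • x) = lam ^ (-(2 / 3 : ℝ)) • V x) ∧
      (∀ x : E³, x ≠ 0 → P (lam • x) = lam ^ (-(4 / 3 : ℝ)) * P x) ∧
      LocallyIntegrableOn (fun x => ‖V x‖ ^ 2) {x : E³ | x ≠ 0} volume ∧
      LocallyIntegrableOn P {x : E³ | x ≠ 0} volume ∧
      (∀ φ : E³ → E³, IsTestFunctionOn ⟨{x : E³ | x ≠ 0}, isOpen_ne⟩ φ →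
        ∫ x, (inner ℝ (V x) (fderiv ℝ φ x (V x)) + P x * VectorCalculus.divergence φ x) = 0) ∧
      (∀ θ : E³ → ℝ, IsTestFunctionOn ⟨{x : E³ | x ≠ 0}, isOpen_ne⟩ θ →
        ∫ x, inner ℝ (V x) (gradient θ x) = 0) ∧
      IntegrableOn (fun x => (‖V x‖ ^ 2 / 2 + P x) * (inner ℝ (V x) x / ‖x‖ ^ 2))
        {x : E³ | 1 < ‖x‖ ∧ ‖x‖ < lam} volume ∧
      (∫ x in {x : E³ | 1 < ‖x‖ ∧ ‖x‖ < lam}, (‖V x‖ ^ 2 / 2 + P x) * (inner ℝ (V x) x / ‖x‖ ^ 2)) < 0 :=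
  -- LANDED: Theorems/PointSinkConeDesingularisationStubOrient.lean (p158443, accepted 2026-08-17)
  Summit.AnomalousDissipation.AnomalousDissipation.Theorems.stub_orient

/-- **Stub 2 — `stub_farFieldNontrivial` (S; provable now).** A cone with non-zero radial energy-flux
log-mean on the fundamental shell `1 < |x| < λ` is non-trivial there in `L²`: if `∫_{shell} |V|² = 0`
then (local integrability off the origin, the closed shell being a compact subset of `ℝ³ ∖ {0}`) `V = 0`
a.e. on the shell, so the flux density vanishes a.e. and its integral is `0`. -/
theorem stub_farFieldNontrivial :
    ∀ (lam : ℝ) (V : E³ → E³) (P : E³ → ℝ), 1 < lam →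
      LocallyIntegrableOn (fun x => ‖V x‖ ^ 2) {x : E³ | x ≠ 0} volume →
      (∫ x in {x : E³ | 1 < ‖x‖ ∧ ‖x‖ < lam}, (‖V x‖ ^ 2 / 2 + P x) * (inner ℝ (V x) x / ‖x‖ ^ 2)) ≠ 0 →
      0 < ∫ x in {x : E³ | 1 < ‖x‖ ∧ ‖x‖ < lam}, ‖V x‖ ^ 2 :=
  -- LANDED: Theorems/PointSinkConeDesingularisationStubFarFieldNontrivial.lean (p158441, accepted 2026-08-17)
  Summit.AnomalousDissipation.AnomalousDissipation.Theorems.stub_farFieldNontrivial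

/-- **Stub 3 — `stub_cascadeSolitonCore` (XL / open-problem class; HARDEST; the lead's).** THE NODE,
MINIMAL FORM: a smooth steady solution `(Q, Pr)` of the UNFORCED unit-viscosity Navier–Stokes system on
`ℝ³` with finite Dirichlet integral whose shell-`L²` far field is SOME non-trivial discretely self-similar
field of degree `−2/3`: `λ > 1`, `V` measurable, `V(λx) = λ^{-2/3}V(x)` off the origin, `‖V‖² ∈ L¹_loc`
off the origin, `0 < ∫_{1<|x|<λ}|V|²`, and `λ^{-5k/3} ∫_{λ^k<|x|<λ^{k+1}} |Q − V|² → 0`. The envelope and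
the positivity of the dissipation are then automatic (stubs 4, 5), so this is `CascadeSoliton`
(stmt-AnomalousDissipation-19036) minus its redundant clauses — and, `PointFluxCone` being a theorem
(`PointFluxCone_of`), it is the crux itself (`coneDesingularisation_iff_cascadeSoliton`, p167258): a
counterexample to Galdi's Liouville problem for steady `D`-solutions in the critical `L²`-mass class.
v5 reshape of v4's `stub_core` (same conclusion with `V` pinned to a given inward flux cone). Why it might
fail: consensus expects Liouville for all `D`-solutions (Galdi X.9.5 `L^{9/2}`, Seregin–Wang 2020, Tsai 2021,
Chae–Wolf, KTW, Wang–Yang 2026 `r^{-2/3} log^{-γ}`, `γ > 1/3` — all strictly inside this decay class: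
`Negative/LpEscape.lean`, `Negative/FarFieldMass.lean`); under `SteadyDSolutionLiouvilleProblem` + Galdi X.5.1
the stub is false (p167258). Blow-down reading (landed tools `stub_blowdownCovariance`): `u_k = λ^{2k/3}Q(λ^k·)`
is a steady vanishing-viscosity family (`ν_k = λ^{-k/3}`) converging to `V` in `L²` of the fundamental shell
with `ν`-independent total dissipation and NO dissipation off the tip. -/
theorem stub_cascadeSolitonCore :
    ∃ (Q : E³ → E³) (Pr : E³ → ℝ), IsSteadyClassicalNS 1 0 Q Pr ∧
      Integrable (fun x => frobeniusNormSq (fderiv ℝ Q x)) ∧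
      ∃ (lam : ℝ) (V : E³ → E³), 1 < lam ∧ AEStronglyMeasurable V volume ∧
        (∀ x : E³, x ≠ 0 → V (lam • x) = lam ^ (-(2 / 3 : ℝ)) • V x) ∧
        LocallyIntegrableOn (fun x => ‖V x‖ ^ 2) {x : E³ | x ≠ 0} volume ∧
        0 < ∫ x in {x : E³ | 1 < ‖x‖ ∧ ‖x‖ < lam}, ‖V x‖ ^ 2 ∧
        Tendsto (fun k : ℕ => (lam ^ k) ^ (-(5 / 3 : ℝ)) *
          ∫ x in {x : E³ | lam ^ k < ‖x‖ ∧ ‖x‖ < lam ^ (k + 1)}, ‖Q x - V x‖ ^ 2) atTop (𝓝 0) := by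
  sorry

/-- **Stub 4 — `stub_envelopeOfFarField` (M; provable now).** The L²-MASS ENVELOPE IS AUTOMATIC: if a
continuous field `Q` is shell-`L²`-asymptotic at rate `o(λ^{5k/3})` to a field `V` that is locally `L²`
off the origin and DSS of degree `−2/3` (`V(λx) = λ^{-2/3} V(x)`), then `∫_{B_R} |Q|² ≤ C R^{5/3}` for
`R ≥ 1`. Proof: `∫_{shell k} |V|² = λ^{5k/3} ∫_{shell 0} |V|²` (change of variables `x = λ^k y`,
`V(λ^k y) = λ^{-2k/3} V(y)` by induction), the shell errors are bounded (a convergent sequence), so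
`∫_{shell k} |Q|² ≤ 2(M + m) λ^{5k/3}`; sum the geometric series over the shells below `R`
(spheres are Lebesgue-null) and add `∫_{B_1} |Q|²`. -/
theorem stub_envelopeOfFarField :
    ∀ (lam : ℝ) (V Q : E³ → E³), 1 < lam → Continuous Q → AEStronglyMeasurable V volume →
      (∀ x : E³, x ≠ 0 → V (lam • x) = lam ^ (-(2 / 3 : ℝ)) • V x) →
      LocallyIntegrableOn (fun x => ‖V x‖ ^ 2) {x : E³ | x ≠ 0} volume →
      Tendsto (fun k : ℕ => (lam ^ k) ^ (-(5 / 3 : ℝ)) *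
          ∫ x in {x : E³ | lam ^ k < ‖x‖ ∧ ‖x‖ < lam ^ (k + 1)}, ‖Q x - V x‖ ^ 2) atTop (𝓝 0) →
      ∃ C : ℝ, ∀ R : ℝ, 1 ≤ R → ∫ x in Metric.ball (0 : E³) R, ‖Q x‖ ^ 2 ≤ C * R ^ (5 / 3 : ℝ) :=
  -- LANDED: Theorems/PointSinkConeDesingularisationStubEnvelopeOfFarField.lean (p158932, accepted 2026-08-17)
  Summit.AnomalousDissipation.AnomalousDissipation.Theorems.stub_envelopeOfFarField

/-- **Stub 5 — `stub_dissipationPosOfFarField` (M; provable now).** POSITIVITY OF THE DISSIPATION IS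
AUTOMATIC: if a `C¹` field `Q` with `∫|∇Q|² < ∞` is shell-`L²`-asymptotic at rate `o(λ^{5k/3})` to a DSS
field `V` of degree `−2/3` that is non-trivial on the fundamental shell, then `0 < ∫ |∇Q|²`. Proof:
otherwise `|∇Q|² = 0` a.e., hence everywhere (continuity), so `Q ≡ a`; if `a = 0` the normalised shell
error is the constant `∫_{shell 0}|V|² > 0`; if `a ≠ 0` it is
`≥ ½|a|² vol(shell 0) λ^{4k/3} − ∫_{shell 0}|V|² → ∞`; either way it does not tend to `0`. -/
theorem stub_dissipationPosOfFarField :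
    ∀ (lam : ℝ) (V Q : E³ → E³), 1 < lam → ContDiff ℝ 1 Q → AEStronglyMeasurable V volume →
      (∀ x : E³, x ≠ 0 → V (lam • x) = lam ^ (-(2 / 3 : ℝ)) • V x) →
      LocallyIntegrableOn (fun x => ‖V x‖ ^ 2) {x : E³ | x ≠ 0} volume →
      0 < ∫ x in {x : E³ | 1 < ‖x‖ ∧ ‖x‖ < lam}, ‖V x‖ ^ 2 →
      Integrable (fun x => frobeniusNormSq (fderiv ℝ Q x)) →
      Tendsto (fun k : ℕ => (lam ^ k) ^ (-(5 / 3 : ℝ)) *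
          ∫ x in {x : E³ | lam ^ k < ‖x‖ ∧ ‖x‖ < lam ^ (k + 1)}, ‖Q x - V x‖ ^ 2) atTop (𝓝 0) →
      0 < ∫ x, frobeniusNormSq (fderiv ℝ Q x) :=
  -- LANDED: Theorems/PointSinkConeDesingularisationStubDissipationPosOfFarField.lean (p159054, accepted 2026-08-17)
  Summit.AnomalousDissipation.AnomalousDissipation.Theorems.stub_dissipationPosOfFarField

/-! ## Class information on the hypothesis (proved; consequences of the landed tools D1 / C¹) -/

/-- **A point-flux cone has a NON-RENORMALISED head** (contrapositive of the landed D1,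
`Theorems.stub_dssFluxRigidity`): for cone data with non-zero flux log-mean there are a `C¹` bounded-slope
`β` with `β 0 = 0` and a test function `θ` off the origin with `∫ β(H) ⟨V, ∇θ⟩ ≠ 0`, `H = ½|V|² + P`. This is
the class information the line's selection mechanism consumes (card `abc-window-selection`: the cone lives
below `C^{1/2}`, its energy sink is a Lagrangian anomaly). -/
theorem pointFluxCone_head_not_renormalised (lam : ℝ) (V : E³ → E³) (P : E³ → ℝ) (hlam : 1 < lam)
    (hV : AEStronglyMeasurable V volume)
    (hVss : ∀ x : E³, x ≠ 0 → V (lam • x) = lam ^ (-(2 / 3 : ℝ)) • V x)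
    (hPss : ∀ x : E³, x ≠ 0 → P (lam • x) = lam ^ (-(4 / 3 : ℝ)) * P x)
    (hVloc : LocallyIntegrableOn (fun x => ‖V x‖ ^ 2) {x : E³ | x ≠ 0} volume)
    (hPloc : LocallyIntegrableOn P {x : E³ | x ≠ 0} volume)
    (hFluxInt : IntegrableOn (fun x => (‖V x‖ ^ 2 / 2 + P x) * (inner ℝ (V x) x / ‖x‖ ^ 2))
      {x : E³ | 1 < ‖x‖ ∧ ‖x‖ < lam} volume)
    (hFlux : (∫ x in {x : E³ | 1 < ‖x‖ ∧ ‖x‖ < lam},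
      (‖V x‖ ^ 2 / 2 + P x) * (inner ℝ (V x) x / ‖x‖ ^ 2)) ≠ 0) :
    ∃ β : ℝ → ℝ, ContDiff ℝ 1 β ∧ (∃ Cβ : ℝ, ∀ t : ℝ, ‖deriv β t‖ ≤ Cβ) ∧ β 0 = 0 ∧
      ∃ θ : E³ → ℝ, IsTestFunctionOn ⟨{x : E³ | x ≠ 0}, isOpen_ne⟩ θ ∧
        (∫ x, β (‖V x‖ ^ 2 / 2 + P x) * inner ℝ (V x) (gradient θ x)) ≠ 0 := by
  by_contra hcon
  push Not at hcon
  exact hFlux (Summit.AnomalousDissipation.AnomalousDissipation.Theorems.stub_dssFluxRigidity lam V P hlam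
    hV hVss hPss hVloc hPloc (fun β hβ hC h0 θ hθ => hcon β hβ hC h0 θ hθ) hFluxInt)

/-- **`PointFluxCone` has no `C¹` witness** (the landed `Theorems.stub_c1ConeFluxless`, Shvydkoy 2018
Lemma 6.1 in DSS generality): cone data that are `C¹` off the origin and solve the steady Euler system
classically there have zero flux log-mean. -/
theorem pointFluxCone_no_C1_witness (lam : ℝ) (V : E³ → E³) (P : E³ → ℝ) (hlam : 1 < lam)
    (hV : ContDiffOn ℝ 1 V {x : E³ | x ≠ 0}) (hP : ContDiffOn ℝ 1 P {x : E³ | x ≠ 0})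
    (hVss : ∀ x : E³, x ≠ 0 → V (lam • x) = lam ^ (-(2 / 3 : ℝ)) • V x)
    (hPss : ∀ x : E³, x ≠ 0 → P (lam • x) = lam ^ (-(4 / 3 : ℝ)) * P x)
    (hEuler : ∀ x : E³, x ≠ 0 → convect V V x + gradient P x = 0)
    (hDiv : ∀ x : E³, x ≠ 0 → VectorCalculus.divergence V x = 0) :
    (∫ x in {x : E³ | 1 < ‖x‖ ∧ ‖x‖ < lam}, (‖V x‖ ^ 2 / 2 + P x) * (inner ℝ (V x) x / ‖x‖ ^ 2)) = 0 :=
  Summit.AnomalousDissipation.AnomalousDissipation.Theorems.stub_c1ConeFluxless lam V P hlam hV hP hVss hPss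
    hEuler hDiv

/-- **The k1 branch made precise.** If EVERY `(−2/3, −4/3)`-DSS weak cone with the integrability of
`PointFluxCone` had a renormalised head (an Onsager-type rigidity for steady weak Euler cones — DiPerna–Lions
renormalisation of the head transport `V·∇H = 0`; true for `C¹` cones by `stub_c1ConeFluxless`, expected up
to `C^{1/2+}`, open below), then `PointFluxCone` is FALSE (and the crux would hold vacuously, by the refuter's
`¬PointFluxCone → ConeDesingularisation`). Stated as `¬ PointFluxCone` so that `ConeDesingularisation_of`
stays the only theorem of this file concluding the crux by name. Recorded to show exactly what the vacuous
route needs; moot since v5 (`PointFluxCone_of`: the wild-box cone is such a non-renormalised witness). -/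
theorem not_pointFluxCone_of_weakConeRenormalisation
    (hR : ∀ (lam : ℝ) (V : E³ → E³) (P : E³ → ℝ), 1 < lam → AEStronglyMeasurable V volume →
      (∀ x : E³, x ≠ 0 → V (lam • x) = lam ^ (-(2 / 3 : ℝ)) • V x) →
      (∀ x : E³, x ≠ 0 → P (lam • x) = lam ^ (-(4 / 3 : ℝ)) * P x) →
      LocallyIntegrableOn (fun x => ‖V x‖ ^ 2) {x : E³ | x ≠ 0} volume →
      LocallyIntegrableOn P {x : E³ | x ≠ 0} volume →
      (∀ φ : E³ → E³, IsTestFunctionOn ⟨{x : E³ | x ≠ 0}, isOpen_ne⟩ φ →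
        ∫ x, (inner ℝ (V x) (fderiv ℝ φ x (V x)) + P x * VectorCalculus.divergence φ x) = 0) →
      (∀ θ : E³ → ℝ, IsTestFunctionOn ⟨{x : E³ | x ≠ 0}, isOpen_ne⟩ θ →
        ∫ x, inner ℝ (V x) (gradient θ x) = 0) →
      ∀ β : ℝ → ℝ, ContDiff ℝ 1 β → (∃ Cβ : ℝ, ∀ t : ℝ, ‖deriv β t‖ ≤ Cβ) → β 0 = 0 →
        ∀ θ : E³ → ℝ, IsTestFunctionOn ⟨{x : E³ | x ≠ 0}, isOpen_ne⟩ θ →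
          ∫ x, β (‖V x‖ ^ 2 / 2 + P x) * inner ℝ (V x) (gradient θ x) = 0) :
    ¬ Summit.AnomalousDissipation.AnomalousDissipation.Theses.PointSink.PointFluxCone := by
  intro h
  obtain ⟨lam, V, P, hlam, hV, hVss, hPss, hVloc, hPloc, hEuler, hDiv, hFluxInt, hFlux⟩ := h
  exact hFlux (Summit.AnomalousDissipation.AnomalousDissipation.Theorems.stub_dssFluxRigidity lam V P hlam
    hV hVss hPss hVloc hPloc (hR lam V P hlam hV hVss hPss hVloc hPloc hEuler hDiv) hFluxInt)

/-! ## Class information on the node (proved; the landed tools p167658) -/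

/-- **The far field of the node is an Euler cone.** For any smooth steady unforced NS₁ solution `(Q, Pr)`
on `ℝ³` and any measurable, locally-`L²`-off-`0`, `(−2/3)`-DSS field `V` with the shell clause of
`stub_cascadeSolitonCore`, `V` is a very weak steady Euler field off the origin (`∫ ⟪V, Dφ·V⟫ = 0` for
divergence-free tests `φ` supported off `0`) and weakly divergence-free there. So the object the stub asks
for hands back a `PointFluxCone`-type datum (minus explicit pressure and flux clause): the node re-enters
the cone class the line set out to desingularise. (`Theorems.cascadeCore_farField_veryWeakEuler`.) -/
theorem node_farField_isEulerCone (Q V : E³ → E³) (Pr : E³ → ℝ) (lam : ℝ) (hlam : 1 < lam)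
    (hNS : IsSteadyClassicalNS 1 0 Q Pr) (hV : AEStronglyMeasurable V volume)
    (hVss : ∀ x : E³, x ≠ 0 → V (lam • x) = lam ^ (-(2 / 3 : ℝ)) • V x)
    (hVloc : LocallyIntegrableOn (fun x => ‖V x‖ ^ 2) {x : E³ | x ≠ 0} volume)
    (hTend : Tendsto (fun k : ℕ => (lam ^ k) ^ (-(5 / 3 : ℝ)) *
      ∫ x in {x : E³ | lam ^ k < ‖x‖ ∧ ‖x‖ < lam ^ (k + 1)}, ‖Q x - V x‖ ^ 2) atTop (𝓝 0)) :
    (∀ φ : E³ → E³, IsTestFunctionOn ⟨{x : E³ | x ≠ 0}, isOpen_ne⟩ φ →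
        (∀ x, VectorCalculus.divergence φ x = 0) → ∫ x, inner ℝ (V x) (fderiv ℝ φ x (V x)) = 0) ∧
      (∀ θ : E³ → ℝ, IsTestFunctionOn ⟨{x : E³ | x ≠ 0}, isOpen_ne⟩ θ →
        ∫ x, inner ℝ (V x) (gradient θ x) = 0) := by
  have hNS' := isSteadyClassicalNS_iff_const.1 hNS
  have hQ : Continuous Q := hNS.smooth_velocity.continuous
  have hshellZ := Summit.AnomalousDissipation.AnomalousDissipation.Theorems.stub_shellDefectScaling Q V lam hlam hVss hTend
  have hann := Summit.AnomalousDissipation.AnomalousDissipation.Theorems.stub_localL2Convergence Q V lam hlam hQ hV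
    hVloc hshellZ
  have htest : ∀ k : ℕ, _ := fun k =>
    Summit.AnomalousDissipation.AnomalousDissipation.Theorems.stub_testedRescaledNS Q Pr hNS' (lam ^ k)
      (pow_pos (one_pos.trans hlam) k)
  exact Summit.AnomalousDissipation.AnomalousDissipation.Theorems.stub_farFieldWeakEuler Q V lam hlam hQ hV hVloc hann
    (fun k => (htest k).1) (fun k => (htest k).2)

/-- **The node charges every large dyadic annulus in `L³`, by its dissipation** (Seregin–Wang 2020 Thm 1.1,
`q = ℓ = 3`, proved in the tree): a universal `δ > 0` with `δ · ∫|∇Q|² < (liminf_R R^{-1/3}‖Q‖_{L³(R/2≤|x|<R)})³`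
for every smooth steady unforced NS₁ solution with `0 < ∫|∇Q|² < ∞`. Profile constraint on any witness of
`stub_cascadeSolitonCore`. (`Theorems.cascadeCore_annular_L3_floor`.) -/
theorem node_annular_L3_floor : ∃ δ : NNReal, 0 < δ ∧ ∀ (Q : E³ → E³) (Pr : E³ → ℝ),
    IsSteadyClassicalNS 1 0 Q Pr → Integrable (fun x => frobeniusNormSq (fderiv ℝ Q x)) →
    0 < ∫ x, frobeniusNormSq (fderiv ℝ Q x) →
    (δ : ENNReal) * ENNReal.ofReal (∫ x, frobeniusNormSq (fderiv ℝ Q x)) <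
      (liminf (sereginWangL3 Q) atTop) ^ 3 := by
  obtain ⟨c, δ, hδ, H⟩ := sereginWang_liouville_L3_annulus_holds
  refine ⟨δ, hδ, fun Q Pr hNS hInt hpos => ?_⟩
  have hNS' := isSteadyClassicalNS_iff_const.1 hNS
  have hprof : IsLerayProfile 1 0 Q Pr := hNS'.isLerayProfile_zero_of_steady
  have hlin : ∫⁻ x, ENNReal.ofReal (frobeniusNormSq (fderiv ℝ Q x)) =
      ENNReal.ofReal (∫ x, frobeniusNormSq (fderiv ℝ Q x)) :=
    (ofReal_integral_eq_lintegral_ofReal hInt (Eventually.of_forall fun x => frobeniusNormSq_nonneg _)).symm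
  by_cases hL : liminf (sereginWangL3 Q) atTop < (⊤ : ENNReal)
  · obtain ⟨-, hsmall⟩ := H Q Pr hprof hNS.smooth_velocity hNS.smooth_pressure hL
    by_contra hle
    push Not at hle
    have hQ0 : Q = 0 := hsmall (by rw [hlin]; exact hle)
    subst hQ0
    simp [frobeniusNormSq_zero] at hpos
  · push Not at hL
    rw [top_le_iff.1 hL, ENNReal.top_pow (by norm_num)]
    exact ENNReal.mul_lt_top ENNReal.coe_lt_top ENNReal.ofReal_lt_top

/-! ## The crux from the line -/

/-- **The crux from the line** — the ONLY theorem of this file concluding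
`Summit.AnomalousDissipation.AnomalousDissipation.Theses.PointSink.ConeDesingularisation`, BY NAME, with no
hypotheses; the registered stubs are invoked (sorries live only in `stub_*`). v5 chain: the hypothesis
`PointFluxCone` is a theorem (`PointFluxCone_of`) and carries nothing the conclusion uses (its far field is
re-quantified), so it is discarded; the node core (stub 3, the open mathematics) ⟹ the conclusion's remaining
clauses: classical-on-`univ` from steady smooth (`isSteadyClassicalNS_iff_const`), envelope (stub 4),
dissipation positivity (stub 5), and the far-field block verbatim. -/
theorem ConeDesingularisation_of :
    Summit.AnomalousDissipation.AnomalousDissipation.Theses.PointSink.ConeDesingularisation := by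
  intro _
  obtain ⟨Q, Pr, hNS, hInt, lam, V, hlam, hV, hVss, hVloc, hVpos, hTend⟩ := stub_cascadeSolitonCore
  have hQ1 : ContDiff ℝ 1 Q := hNS.smooth_velocity.of_le (mod_cast le_top)
  exact ⟨Q, Pr, isSteadyClassicalNS_iff_const.1 hNS,
    stub_envelopeOfFarField lam V Q hlam hQ1.continuous hV hVss hVloc hTend, hInt,
    stub_dissipationPosOfFarField lam V Q hlam hQ1 hV hVss hVloc hVpos hInt hTend,
    lam, V, hlam, hV, hVss, hVloc, hVpos, hTend⟩

end Summit.AnomalousDissipation.AnomalousDissipation.Cruxes.ConeDesingularisation.Sketch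

end
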